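import Mathlib
import Summits.ValiantsHypothesis.ValiantsHypothesis.Theorems.RigidityForcesSymmetryRankRigidMinimalReprLaplaceFiveOnShellBasics

/-!
# ValiantsHypothesis / RigidityForcesSymmetry — crux `LaplaceOptimalFive` (stmt-ValiantsHypothesis-24813), line
`shallow_collision`, stub S1 `stub_onShell_five`: CASE B (no junk) ⇒ weight ≥ 120 — the COVER argument.

If every flattening sum vanishes at every word with a collision cut by the flattening (hypothesis `hJ`), then on
each flattening `{S₀, S₀ᶜ}` the number of terms is at least the number of letter sets `A = π(S₀)` (over
permutation words `π`) at which the flattening sum is nonzero (`card_supp_le_terms`: the vectors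
`t ↦ u t π_A` / `w t π_A` are linearly independent, tested against the mixed words `(π_A on S₀, π_A' off S₀)`,
which carry a cut collision when `A ≠ A'`).  Exactness at the `120` permutation words makes the blocks
`{π : π(S₀) = A}` with nonzero sum cover `S₅`; a block has at most `|S₀|!(5−|S₀|)!` elements
(`card_block_le`), whence `120 ≤ weight` (`weight_ge_of_noJunk`).

Honest framing.  A helper toward S1; nothing here proves `LaplaceOptimalFive` (OPEN), `RankRigidMinimalRepr`
or `VP ≠ VNP`.  No definitions, no `sorry`; Mathlib only.
-/

set_option linter.dupNamespace false

namespace Summit.ValiantsHypothesis.ValiantsHypothesis.Theorems.RigidityForcesSymmetryRankRigidMinimalRepr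

namespace LaplaceFiveOnShell

open Finset

variable {N : ℕ} (T : Finset (Fin N)) (S : Fin N → Finset (Fin 5)) (u w : Fin N → (Fin 5 → Fin 5) → ℂ)

/-- **Block count.**  The permutations of `Fin 5` mapping `S₀` onto `A` (`|A| = |S₀|`) number at most
`|S₀|!·(5 − |S₀|)!` (they embed into `(S₀ ↪ A) × (S₀ᶜ ↪ Aᶜ)`). [folklore] -/
theorem card_block_le (S₀ A : Finset (Fin 5)) (hcard : A.card = S₀.card) :
    ((Finset.univ : Finset (Equiv.Perm (Fin 5))).filter (fun π : Equiv.Perm (Fin 5) => S₀.image ⇑π = A)).card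
      ≤ S₀.card.factorial * (5 - S₀.card).factorial := by
  classical
  have hmemA : ∀ π : Equiv.Perm (Fin 5), S₀.image ⇑π = A → ∀ x, x ∈ S₀ → π x ∈ A := by
    intro π hπ x hx
    rw [← hπ]; exact Finset.mem_image_of_mem _ hx
  have hmemAc : ∀ π : Equiv.Perm (Fin 5), S₀.image ⇑π = A → ∀ x, x ∈ S₀ᶜ → π x ∈ Aᶜ := by
    intro π hπ x hx
    rw [Finset.mem_compl] at hx ⊢
    intro h
    rw [← hπ, Finset.mem_image] at h
    obtain ⟨y, hy, hyx⟩ := h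
    exact hx (π.injective hyx ▸ hy)
  let f : {π : Equiv.Perm (Fin 5) // S₀.image ⇑π = A} → (↥S₀ ↪ ↥A) × (↥(S₀ᶜ) ↪ ↥(Aᶜ)) :=
    fun π => (⟨fun x => ⟨π.1 x, hmemA π.1 π.2 x x.2⟩,
                fun x y h => Subtype.ext (π.1.injective (congrArg Subtype.val h))⟩,
              ⟨fun x => ⟨π.1 x, hmemAc π.1 π.2 x x.2⟩,
                fun x y h => Subtype.ext (π.1.injective (congrArg Subtype.val h))⟩)
  have hf : Function.Injective f := by
    intro π π' h
    apply Subtype.ext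
    apply Equiv.ext
    intro x
    by_cases hx : x ∈ S₀
    · have := congrArg (fun e => ((e.1 ⟨x, hx⟩ : ↥A) : Fin 5)) h
      exact this
    · have hx' : x ∈ S₀ᶜ := Finset.mem_compl.mpr hx
      have := congrArg (fun e => ((e.2 ⟨x, hx'⟩ : ↥(Aᶜ)) : Fin 5)) h
      exact this
  have h1 := Fintype.card_le_of_injective f hf
  rw [Fintype.card_subtype, Fintype.card_prod, Fintype.card_embedding_eq, Fintype.card_embedding_eq,
    Fintype.card_coe, Fintype.card_coe, Fintype.card_coe, Fintype.card_coe, hcard,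
    Finset.card_compl, Finset.card_compl, Fintype.card_fin, hcard, Nat.descFactorial_self,
    Nat.descFactorial_self] at h1
  exact h1

/-- A slot set of `Fin 5` is never its own complement (`5` is odd). [folklore] -/
theorem ne_compl_self (S₀ : Finset (Fin 5)) : S₀ ≠ S₀ᶜ := by
  intro h
  have := congrArg Finset.card h
  rw [Finset.card_compl, Fintype.card_fin] at this
  have hle : S₀.card ≤ 5 := by simpa only [Fintype.card_fin] using Finset.card_le_univ S₀
  omega

/-- Precomposing with a swap of two members of `X` does not change the image of `X`. [folklore] -/
theorem image_comp_swap_of_mem (f : Fin 5 → Fin 5) (X : Finset (Fin 5)) {a b : Fin 5} (ha : a ∈ X) (hb : b ∈ X) :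
    X.image (f ∘ ⇑(Equiv.swap a b)) = X.image f := by
  classical
  have hmem : ∀ x ∈ X, Equiv.swap a b x ∈ X := by
    intro x hx
    rcases eq_or_ne x a with rfl | hxa
    · rw [Equiv.swap_apply_left]; exact hb
    rcases eq_or_ne x b with rfl | hxb
    · rw [Equiv.swap_apply_right]; exact ha
    rw [Equiv.swap_apply_of_ne_of_ne hxa hxb]; exact hx
  ext y
  simp only [Finset.mem_image, Function.comp]
  constructor
  · rintro ⟨x, hx, rfl⟩; exact ⟨_, hmem x hx, rfl⟩
  · rintro ⟨x, hx, rfl⟩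
    refine ⟨Equiv.swap a b x, hmem x hx, ?_⟩
    rw [Equiv.swap_apply_self]

/-- Precomposing with a swap of two non-members of `X` does not change the image of `X`. [folklore] -/
theorem image_comp_swap_of_not_mem (f : Fin 5 → Fin 5) (X : Finset (Fin 5)) {a b : Fin 5} (ha : a ∉ X)
    (hb : b ∉ X) : X.image (f ∘ ⇑(Equiv.swap a b)) = X.image f := by
  refine Finset.image_congr fun x hx => ?_
  have hx' : x ∈ X := Finset.mem_coe.mp hx
  simp only [Function.comp]
  rw [Equiv.swap_apply_of_ne_of_ne (ne_of_mem_of_not_mem hx' ha) (ne_of_mem_of_not_mem hx' hb)]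

/-- **Terms dominate support (CASE B, one flattening).**  If the flattening sum of `{S₀, S₀ᶜ}` vanishes at
every word with a collision cut by the flattening, then the flattening carries at least as many terms of `T` as
there are letter sets `π(S₀)` (over permutations `π`) with nonzero flattening sum at `π`. [folklore] -/
theorem card_supp_le_terms (S₀ : Finset (Fin 5)) (p₀ q₀ : Fin 5) (hp₀ : p₀ ∈ S₀) (hq₀ : q₀ ∉ S₀)
    (ho2 : ∀ t v v', (S t).image v = (S t).image v' → u t v = u t v')
    (ho4 : ∀ t v v', ((S t)ᶜ).image v = ((S t)ᶜ).image v' → w t v = w t v')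
    (hJ : ∀ μ : Fin 5 → Fin 5, μ p₀ = μ q₀ →
      (∑ t ∈ T.filter (fun t => S t = S₀), u t μ * w t μ)
        + ∑ t ∈ T.filter (fun t => S t = S₀ᶜ), u t μ * w t μ = 0) :
    (((Finset.univ : Finset (Equiv.Perm (Fin 5))).filter (fun π : Equiv.Perm (Fin 5) =>
        (∑ t ∈ T.filter (fun t => S t = S₀), u t ⇑π * w t ⇑π)
          + ∑ t ∈ T.filter (fun t => S t = S₀ᶜ), u t ⇑π * w t ⇑π ≠ 0)).image
        (fun π : Equiv.Perm (Fin 5) => S₀.image ⇑π)).card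
      ≤ (T.filter (fun t => S t = S₀ ∨ S t = S₀ᶜ)).card := by
  classical
  set D : (Fin 5 → Fin 5) → ℂ := fun v =>
    (∑ t ∈ T.filter (fun t => S t = S₀), u t v * w t v)
      + ∑ t ∈ T.filter (fun t => S t = S₀ᶜ), u t v * w t v with hD
  set Pf := (Finset.univ : Finset (Equiv.Perm (Fin 5))).filter (fun π : Equiv.Perm (Fin 5) => D ⇑π ≠ 0) with hPf
  set Supp := Pf.image (fun π : Equiv.Perm (Fin 5) => S₀.image ⇑π) with hSupp
  set TF := T.filter (fun t => S t = S₀ ∨ S t = S₀ᶜ) with hTF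
  have hsel : ∀ A : ↥Supp, ∃ π : Equiv.Perm (Fin 5), D ⇑π ≠ 0 ∧ S₀.image ⇑π = A.1 := by
    intro A
    obtain ⟨π, hπ, hA⟩ := Finset.mem_image.mp A.2
    exact ⟨π, (Finset.mem_filter.mp hπ).2, hA⟩
  choose sel hselD hselA using hsel
  -- mixed words and their flattening sums
  have hmix : ∀ (A A₀ : ↥Supp) (α β : Fin 5 → Fin 5), S₀.image α = S₀.image ⇑(sel A) →
      (S₀ᶜ).image β = (S₀ᶜ).image ⇑(sel A₀) →
      ∑ t ∈ TF, (if S t = S₀ then u t ⇑(sel A) else w t ⇑(sel A))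
          * (if S t = S₀ then w t ⇑(sel A₀) else u t ⇑(sel A₀))
        = D (fun i => if i ∈ S₀ then α i else β i) := by
    intro A A₀ α β hα hβ
    set μ : Fin 5 → Fin 5 := fun i => if i ∈ S₀ then α i else β i with hμ
    have hdisj : Disjoint (T.filter (fun t => S t = S₀)) (T.filter (fun t => S t = S₀ᶜ)) :=
      Finset.disjoint_filter.mpr fun t _ h1 h2 => ne_compl_self S₀ (h1.symm.trans h2)
    have hsplit : TF = T.filter (fun t => S t = S₀) ∪ T.filter (fun t => S t = S₀ᶜ) := by
      rw [hTF, ← Finset.filter_or]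
    have hμα : S₀.image μ = S₀.image α :=
      Finset.image_congr fun i hi => by rw [hμ]; simp only; rw [if_pos (Finset.mem_coe.mp hi)]
    have hμβ : (S₀ᶜ).image μ = (S₀ᶜ).image β :=
      Finset.image_congr fun i hi => by
        rw [hμ]; simp only; rw [if_neg (Finset.mem_compl.mp (Finset.mem_coe.mp hi))]
    rw [hsplit, Finset.sum_union hdisj, hD]
    congr 1
    · refine Finset.sum_congr rfl fun t ht => ?_
      have hS : S t = S₀ := (Finset.mem_filter.mp ht).2
      rw [if_pos hS, if_pos hS]
      have e1 : u t μ = u t ⇑(sel A) := ho2 t μ _ (by rw [hS, hμα, hα])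
      have e2 : w t μ = w t ⇑(sel A₀) := ho4 t μ _ (by rw [hS, hμβ, hβ])
      rw [e1, e2]
    · refine Finset.sum_congr rfl fun t ht => ?_
      have hS : S t = S₀ᶜ := (Finset.mem_filter.mp ht).2
      have hS' : ¬ S t = S₀ := fun h => ne_compl_self S₀ (h.symm.trans hS)
      rw [if_neg hS', if_neg hS']
      have e1 : u t μ = u t ⇑(sel A₀) := ho2 t μ _ (by rw [hS, hμβ, hβ])
      have e2 : w t μ = w t ⇑(sel A) := ho4 t μ _ (by rw [hS, compl_compl, hμα, hα])
      rw [e1, e2, mul_comm]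
  -- off-diagonal mixed words: rearranged to collide at `(p₀, q₀)`, their flattening sum vanishes
  have hoff : ∀ A A₀ : ↥Supp, A ≠ A₀ →
      D (fun i => if i ∈ S₀ then (sel A) i else (sel A₀) i) = 0 := by
    intro A A₀ hne
    have hne' : A.1 ≠ A₀.1 := fun h => hne (Subtype.ext h)
    have hcardA : A.1.card = S₀.card := by
      rw [← hselA A]; exact Finset.card_image_of_injective _ (sel A).injective
    have hcardA₀ : A₀.1.card = S₀.card := by
      rw [← hselA A₀]; exact Finset.card_image_of_injective _ (sel A₀).injective
    have hns : ¬ A.1 ⊆ A₀.1 := fun h =>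
      hne' (Finset.eq_of_subset_of_card_le h (by rw [hcardA, hcardA₀]))
    obtain ⟨a, haA, haA₀⟩ := Finset.not_subset.mp hns
    rw [← hselA A, Finset.mem_image] at haA
    obtain ⟨p, hp, hpa⟩ := haA
    set q : Fin 5 := (sel A₀).symm a with hq
    have hqa : sel A₀ q = a := (sel A₀).apply_symm_apply a
    have hqS : q ∉ S₀ := by
      intro hq'
      apply haA₀
      rw [← hselA A₀, Finset.mem_image]
      exact ⟨q, hq', hqa⟩
    -- the rearranged words
    set α : Fin 5 → Fin 5 := ⇑(sel A) ∘ ⇑(Equiv.swap p₀ p) with hα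
    set β : Fin 5 → Fin 5 := ⇑(sel A₀) ∘ ⇑(Equiv.swap q₀ q) with hβ
    have hαS : S₀.image α = S₀.image ⇑(sel A) := image_comp_swap_of_mem _ _ hp₀ hp
    have hβS : (S₀ᶜ).image β = (S₀ᶜ).image ⇑(sel A₀) :=
      image_comp_swap_of_mem _ _ (Finset.mem_compl.mpr hq₀) (Finset.mem_compl.mpr hqS)
    have h1 := hmix A A₀ ⇑(sel A) ⇑(sel A₀) rfl rfl
    have h2 := hmix A A₀ α β hαS hβS
    rw [← h1, h2]
    apply hJ
    simp only [if_pos hp₀, if_neg hq₀]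
    rw [hα, hβ]
    simp only [Function.comp, Equiv.swap_apply_left]
    rw [hpa, hqa]
  -- diagonal mixed word is the permutation itself
  have hdiag : ∀ A₀ : ↥Supp, D (fun i => if i ∈ S₀ then sel A₀ i else sel A₀ i) ≠ 0 := by
    intro A₀
    have : (fun i => if i ∈ S₀ then sel A₀ i else sel A₀ i) = ⇑(sel A₀) := by
      funext i; exact ite_self _
    rw [this]; exact hselD A₀
  -- linear independence of the `S₀`-side value vectors
  have hli : LinearIndependent ℂ (fun (A : ↥Supp) (t : ↥TF) =>
      if S t.1 = S₀ then u t.1 ⇑(sel A) else w t.1 ⇑(sel A)) := by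
    rw [Fintype.linearIndependent_iff]
    intro g hg A₀
    have hpt : ∀ t : ↥TF, ∑ A, g A * (if S t.1 = S₀ then u t.1 ⇑(sel A) else w t.1 ⇑(sel A)) = 0 := by
      intro t
      have := congrFun hg t
      simpa only [Finset.sum_apply, Pi.smul_apply, smul_eq_mul, Pi.zero_apply] using this
    have hzero : ∑ t : ↥TF, (∑ A, g A * (if S t.1 = S₀ then u t.1 ⇑(sel A) else w t.1 ⇑(sel A)))
        * (if S t.1 = S₀ then w t.1 ⇑(sel A₀) else u t.1 ⇑(sel A₀)) = 0 :=
      Finset.sum_eq_zero fun t _ => by rw [hpt t, zero_mul]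
    have hswap : ∑ t : ↥TF, (∑ A, g A * (if S t.1 = S₀ then u t.1 ⇑(sel A) else w t.1 ⇑(sel A)))
        * (if S t.1 = S₀ then w t.1 ⇑(sel A₀) else u t.1 ⇑(sel A₀))
        = ∑ A, g A * D (fun i => if i ∈ S₀ then sel A i else sel A₀ i) := by
      rw [Finset.sum_congr rfl (fun t _ => Finset.sum_mul _ _ _), Finset.sum_comm]
      refine Finset.sum_congr rfl fun A _ => ?_
      rw [← hmix A A₀ ⇑(sel A) ⇑(sel A₀) rfl rfl, Finset.mul_sum, ← Finset.sum_coe_sort TF]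
      refine Finset.sum_congr rfl fun t _ => ?_
      ring
    rw [hswap, Finset.sum_eq_single A₀] at hzero
    · rcases mul_eq_zero.mp hzero with h | h
      · exact h
      · exact absurd h (hdiag A₀)
    · intro A _ hA
      rw [hoff A A₀ hA, mul_zero]
    · intro h; exact absurd (Finset.mem_univ A₀) h
  have hcard := hli.fintype_card_le_finrank
  rw [Module.finrank_fintype_fun_eq_card, Fintype.card_coe, Fintype.card_coe] at hcard
  exact hcard

/-- **CASE B of S1 (no junk ⇒ weight ≥ 120).**  If on every flattening `{S₀, S₀ᶜ}` (`S₀` one of the fifteen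
small slot sets) the flattening sum vanishes at every word with a collision cut by it, and no term sits on the
empty or the full slot set, then the Laplace weight is at least `5! = 120`: the blocks `{π : π(S₀) = A}` with
nonzero flattening sum cover the `120` permutation words (exactness), each block has `≤ |S₀|!(5−|S₀|)!` elements,
and each flattening has at least as many terms as supported letter sets. [folklore] -/
theorem weight_ge_of_noJunk
    (hid : ∀ v : Fin 5 → Fin 5, (∑ t ∈ T, u t v * w t v) = if Function.Injective v then 1 else 0)
    (ho2 : ∀ t v v', (S t).image v = (S t).image v' → u t v = u t v')
    (ho4 : ∀ t v v', ((S t)ᶜ).image v = ((S t)ᶜ).image v' → w t v = w t v')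
    (hne : ∀ t ∈ T, S t ≠ ∅ ∧ S t ≠ Finset.univ)
    (hJall : ∀ S₀ ∈ ({ {0}, {1}, {2}, {3}, {4}, {0, 1}, {0, 2}, {0, 3}, {0, 4}, {1, 2}, {1, 3}, {1, 4}, {2, 3}, {2, 4}, {3, 4} } : Finset (Finset (Fin 5))),
      ∃ p₀ ∈ S₀, ∃ q₀, q₀ ∉ S₀ ∧ ∀ μ : Fin 5 → Fin 5, μ p₀ = μ q₀ →
        (∑ t ∈ T.filter (fun t => S t = S₀), u t μ * w t μ)
          + ∑ t ∈ T.filter (fun t => S t = S₀ᶜ), u t μ * w t μ = 0) :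
    Nat.factorial 5 ≤ ∑ t ∈ T, (S t).card.factorial * (5 - (S t).card).factorial := by
  classical
  set REPS : Finset (Finset (Fin 5)) := { {0}, {1}, {2}, {3}, {4}, {0, 1}, {0, 2}, {0, 3}, {0, 4}, {1, 2}, {1, 3}, {1, 4}, {2, 3}, {2, 4}, {3, 4} } with hREPS
  -- every term lives on exactly one representative flattening
  have hrep : ∀ t ∈ T, ∃ S₀ ∈ REPS, S t = S₀ ∨ S t = S₀ᶜ := by
    intro t ht
    obtain ⟨h0, h1⟩ := hne t ht
    have key : ∀ X : Finset (Fin 5), X ≠ ∅ → X ≠ Finset.univ → ∃ S₀ ∈ REPS, X = S₀ ∨ X = S₀ᶜ := by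
      rw [hREPS]; decide
    exact key (S t) h0 h1
  have hR : ∀ S₀ ∈ REPS, ∀ S₁ ∈ REPS, S₀ ≠ S₁ → S₀ ≠ S₁ᶜ := by rw [hREPS]; decide
  have hdisjTF : ∀ S₀ ∈ REPS, ∀ S₁ ∈ REPS, S₀ ≠ S₁ →
      Disjoint (T.filter (fun t => S t = S₀ ∨ S t = S₀ᶜ)) (T.filter (fun t => S t = S₁ ∨ S t = S₁ᶜ)) := by
    intro S₀ h₀ S₁ h₁ hne01
    refine Finset.disjoint_filter.mpr fun t _ ht0 ht1 => ?_
    rcases ht0 with h0 | h0 <;> rcases ht1 with h1 | h1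
    · exact hne01 (h0.symm.trans h1)
    · exact hR S₀ h₀ S₁ h₁ hne01 (h0.symm.trans h1)
    · exact hR S₁ h₁ S₀ h₀ (Ne.symm hne01) (h1.symm.trans h0)
    · exact hne01 (compl_injective (h0.symm.trans h1))
  have hT : T = REPS.biUnion (fun S₀ => T.filter (fun t => S t = S₀ ∨ S t = S₀ᶜ)) := by
    ext t
    simp only [Finset.mem_biUnion, Finset.mem_filter]
    constructor
    · intro ht
      obtain ⟨S₀, h, h'⟩ := hrep t ht
      exact ⟨S₀, h, ht, h'⟩
    · rintro ⟨S₀, -, ht, -⟩; exact ht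
  -- a flattening's terms, split into its two fibers
  have hfib : ∀ (S₀ : Finset (Fin 5)) (f : Fin N → ℂ),
      ∑ t ∈ T.filter (fun t => S t = S₀ ∨ S t = S₀ᶜ), f t
        = (∑ t ∈ T.filter (fun t => S t = S₀), f t) + ∑ t ∈ T.filter (fun t => S t = S₀ᶜ), f t := by
    intro S₀ f
    rw [Finset.filter_or, Finset.sum_union]
    exact Finset.disjoint_filter.mpr fun t _ h1 h2 => ne_compl_self S₀ (h1.symm.trans h2)
  -- exactness at a permutation word, regrouped by representative flattenings
  have hE1 : ∀ π : Equiv.Perm (Fin 5), ∑ S₀ ∈ REPS,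
      ((∑ t ∈ T.filter (fun t => S t = S₀), u t ⇑π * w t ⇑π)
        + ∑ t ∈ T.filter (fun t => S t = S₀ᶜ), u t ⇑π * w t ⇑π) = 1 := by
    intro π
    have h := hid ⇑π
    rw [if_pos π.injective] at h
    rw [← h]
    have : ∑ t ∈ T, u t ⇑π * w t ⇑π
        = ∑ t ∈ REPS.biUnion (fun S₀ => T.filter (fun t => S t = S₀ ∨ S t = S₀ᶜ)), u t ⇑π * w t ⇑π := by
      rw [← hT]
    rw [this, Finset.sum_biUnion hdisjTF]
    exact Finset.sum_congr rfl fun S₀ _ => (hfib S₀ _).symm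
  -- cover of the permutation words
  have hcov : ∀ π : Equiv.Perm (Fin 5), ∃ S₀ ∈ REPS,
      (∑ t ∈ T.filter (fun t => S t = S₀), u t ⇑π * w t ⇑π)
        + ∑ t ∈ T.filter (fun t => S t = S₀ᶜ), u t ⇑π * w t ⇑π ≠ 0 := by
    intro π
    by_contra h
    push Not at h
    have := hE1 π
    rw [Finset.sum_eq_zero (fun S₀ hS₀ => h S₀ hS₀)] at this
    exact zero_ne_one this
  have hsub : (Finset.univ : Finset (Equiv.Perm (Fin 5))) ⊆ REPS.biUnion (fun S₀ =>
      (((Finset.univ : Finset (Equiv.Perm (Fin 5))).filter (fun π : Equiv.Perm (Fin 5) =>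
          (∑ t ∈ T.filter (fun t => S t = S₀), u t ⇑π * w t ⇑π)
            + ∑ t ∈ T.filter (fun t => S t = S₀ᶜ), u t ⇑π * w t ⇑π ≠ 0)).image
          (fun π : Equiv.Perm (Fin 5) => S₀.image ⇑π)).biUnion
        (fun A => (Finset.univ : Finset (Equiv.Perm (Fin 5))).filter
          (fun π : Equiv.Perm (Fin 5) => S₀.image ⇑π = A))) := by
    intro π _
    rw [Finset.mem_biUnion]
    obtain ⟨S₀, hS₀, hD⟩ := hcov π
    refine ⟨S₀, hS₀, ?_⟩
    rw [Finset.mem_biUnion]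
    exact ⟨S₀.image ⇑π, Finset.mem_image.mpr ⟨π, Finset.mem_filter.mpr ⟨Finset.mem_univ _, hD⟩, rfl⟩,
      Finset.mem_filter.mpr ⟨Finset.mem_univ _, rfl⟩⟩
  have h120 : Nat.factorial 5 = (Finset.univ : Finset (Equiv.Perm (Fin 5))).card := by
    rw [Finset.card_univ, Fintype.card_perm, Fintype.card_fin]
  rw [h120]
  refine le_trans (Finset.card_le_card hsub) ?_
  refine le_trans Finset.card_biUnion_le ?_
  -- compare with the weight, representative by representative
  have hTsum : ∑ t ∈ T, (S t).card.factorial * (5 - (S t).card).factorial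
      = ∑ S₀ ∈ REPS, ∑ t ∈ T.filter (fun t => S t = S₀ ∨ S t = S₀ᶜ),
          (S t).card.factorial * (5 - (S t).card).factorial := by
    have : ∑ t ∈ T, (S t).card.factorial * (5 - (S t).card).factorial
        = ∑ t ∈ REPS.biUnion (fun S₀ => T.filter (fun t => S t = S₀ ∨ S t = S₀ᶜ)),
            (S t).card.factorial * (5 - (S t).card).factorial := by
      rw [← hT]
    rw [this, Finset.sum_biUnion hdisjTF]
  rw [hTsum]
  refine Finset.sum_le_sum fun S₀ hS₀ => ?_
  refine le_trans Finset.card_biUnion_le ?_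
  -- each block is small, and there are at most `#terms` supported letter sets
  have hblocks : ∀ A ∈ (((Finset.univ : Finset (Equiv.Perm (Fin 5))).filter (fun π : Equiv.Perm (Fin 5) =>
          (∑ t ∈ T.filter (fun t => S t = S₀), u t ⇑π * w t ⇑π)
            + ∑ t ∈ T.filter (fun t => S t = S₀ᶜ), u t ⇑π * w t ⇑π ≠ 0)).image
          (fun π : Equiv.Perm (Fin 5) => S₀.image ⇑π)),
      ((Finset.univ : Finset (Equiv.Perm (Fin 5))).filter
          (fun π : Equiv.Perm (Fin 5) => S₀.image ⇑π = A)).card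
        ≤ S₀.card.factorial * (5 - S₀.card).factorial := by
    intro A hA
    obtain ⟨π, -, rfl⟩ := Finset.mem_image.mp hA
    exact card_block_le S₀ _ (Finset.card_image_of_injective _ π.injective)
  refine le_trans (Finset.sum_le_sum hblocks) ?_
  rw [Finset.sum_const, smul_eq_mul]
  obtain ⟨p₀, hp₀, q₀, hq₀, hJ⟩ := hJall S₀ hS₀
  have hsupp := card_supp_le_terms T S u w S₀ p₀ q₀ hp₀ hq₀ ho2 ho4 hJ
  refine le_trans (Nat.mul_le_mul_right _ hsupp) ?_
  -- the flattening's own weight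
  have hwt : ∀ t ∈ T.filter (fun t => S t = S₀ ∨ S t = S₀ᶜ),
      (S t).card.factorial * (5 - (S t).card).factorial = S₀.card.factorial * (5 - S₀.card).factorial := by
    intro t ht
    rcases (Finset.mem_filter.mp ht).2 with h | h
    · rw [h]
    · rw [h, weight_compl]
  rw [Finset.sum_congr rfl hwt, Finset.sum_const, smul_eq_mul]

end LaplaceFiveOnShell

end Summit.ValiantsHypothesis.ValiantsHypothesis.Theorems.RigidityForcesSymmetryRankRigidMinimalRepr
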